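import Summits.QuantumFields.BalabanUV.Beta.GAN24.BornBorderContactLineage

/-!
# `BalabanUV.Beta.GAN24.CombBornBorderContactPairCount` — row G-an2-4 ∕ (CONV-C), TRANSFER-III, the (III′) S-slot (b), the born-V contact PAIR `hPcV` of road-P2 M.104: **THE
# ARITHMETIC OF THE PAIR COUNT AT THE MERGED GAUGE LETTER `A` AND an1's `(d+1)!` NORMALISATIONS** — leaf-03 g56's (E) `BornBorderContactPairCount` (`polyPair_le`,
# `weighted_pair_le_of_cells`) with `8·Lc ↦ A` in the gauge letters (`α_g = A·C₁·u`, `α_Δ = A·c_Δ·u`), the polynomial `Lc(32 + 288Lc + 512Lc²) ↦ 4A + 4A² + 4ALc + 8A²Lc`, and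
# the prefactor ∕ count ABSTRACTED as letters `Φ, Cn ≥ 0` (at the OWNER's sym (14)–(16): `Φ = (4!·Lc^4)⁻¹`, `Cn = (2Lc)^4·(4·(4!·(Lc^4·ℓ)))`) (OWNER `b2b-balaban-gan24-p1` gen 55; `HCV-DESIGN-g55.md` §2)

NOT IN PRINT — OUR BOOKKEEPING ([folklore] pure real algebra, the (E) proof token for token: `set` atoms, `polyPairA_le`, leaf-03's `exp_recenter_*`, leaf-02's `units_le`; 0 `def`,
0 cited fact, 0 `def … : Prop`, 0 sorry; NO estimate of Bałaban's).
HONEST FRAMING (cell contract, verbatim): «discharging `BetaPertH` makes Bałaban's UV stability UNCONDITIONAL — a real constructive-QFT result; it is NOT the continuum limit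
and NOT the Clay problem.»  HONEST DEPENDENCY (verbatim): «continuum YM on T⁴ ⇐ BetaPertH ∧ nine spine estimates (0/9 proved); BetaPertH ⇐ (D1) ∧ (D4) ∧ CAP+tail; G-an2-4
gates asym, D1 and NE2/3/4.»  Discharges NO letter; NEVER «G-an2-4 closed» as (CONV-C); NOT D1, NOT BetaPertH, NOT continuum, NOT Clay.  2026-08-28; no existing file touched.

## What is proved
`polyPairA_le` (the pair cell polynomial at the letters `A·C₁·u`, `A·c_Δ·u`), **`weighted_comb_pair_le_of_cells`** (the weighted pair difference from the two pair cell bounds in the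
shape of the OWNER's (16) `SymContactBorderPairEntryBound`: `≤ |cVH|·C_pair·((n+1)·(Lc⁻¹)^{n+1})·e^{−(κ∕96)(|x−u′|₁+|z−u′|₁)}`).
-/

open Literature.MathematicalPhysics.QuantumFieldTheory
open Literature.MathematicalPhysics.QuantumFieldTheory.Balaban1983to89
open Literature.MathematicalPhysics.QuantumFieldTheory.Balaban1983to89.Beta
open B4ContourShift (supNorm supNorm_nonneg)
open B12Sec2to5 (l1 l1_nonneg)
open ExpKernelCalculus (Zl Zl_nonneg)
open AffineAveraging (Site)
open AveragingHessianKernels (ell)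
open Summit.QuantumFields.BalabanUV.Beta.GAN24.ContactLambdaCellBound (exp_supNorm_add_le_exp_l1)
open Summit.QuantumFields.BalabanUV.Beta.GAN24.BornLambdaContactLineage (units_le)
open Summit.QuantumFields.BalabanUV.Beta.GAN24.BornBorderContactLineage (exp_recenter_right_le exp_recenter_left_le)

namespace Summit.QuantumFields.BalabanUV.Beta.GAN24.CombBornBorderContactPairCount

/-- [folklore] **THE PAIR CELL POLYNOMIAL** of (B) at `K_B = C₁·u`, `α_g = 8·Lc·C₁·u`, `K_Δ = c_Δ·u`, `α_Δ = 8·Lc·c_Δ·u` (all of `T_b, T_Δ, C₁, c_Δ, u, n ≥ 0`):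
`T_b·(K_B·A(α_Δ) + P(α_Δ,α_g) + K_Δ·A(α_g)) + T_Δ·(K_B·A(α_g) + P(α_g,α_g) + K_B·A(α_g)) + T_b·(K_Δ·A(α_g) + P(α_g,α_Δ) + K_B·A(α_Δ))`
`≤ (2·T_b·C₁·c_Δ + T_Δ·C₁²)·u²·((n+1)·(Lc·(32 + 288·Lc + 512·Lc²)))` (`A(α) = 2α + 2α·Lc·n`, `P(a,b) = 4ab + 8ab·Lc·n`). -/
theorem polyPairA_le {Lc : ℕ} {Tb TΔ C₁ cΔ u A : ℝ} (hTb : 0 ≤ Tb) (hTΔ : 0 ≤ TΔ) (hC₁ : 0 ≤ C₁) (hcΔ : 0 ≤ cΔ) (hA : 0 ≤ A) (n : ℕ) :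
    Tb * ((C₁ * u) * (2 * (A * cΔ * u) + 2 * (A * cΔ * u) * Lc * n)
          + (4 * ((A * cΔ * u) * (A * C₁ * u)) + 2 * (4 * ((A * cΔ * u) * (A * C₁ * u))) * Lc * n)
          + (cΔ * u) * (2 * (A * C₁ * u) + 2 * (A * C₁ * u) * Lc * n))
      + TΔ * ((C₁ * u) * (2 * (A * C₁ * u) + 2 * (A * C₁ * u) * Lc * n)
          + (4 * ((A * C₁ * u) * (A * C₁ * u)) + 2 * (4 * ((A * C₁ * u) * (A * C₁ * u))) * Lc * n)
          + (C₁ * u) * (2 * (A * C₁ * u) + 2 * (A * C₁ * u) * Lc * n))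
      + Tb * ((cΔ * u) * (2 * (A * C₁ * u) + 2 * (A * C₁ * u) * Lc * n)
          + (4 * ((A * C₁ * u) * (A * cΔ * u)) + 2 * (4 * ((A * C₁ * u) * (A * cΔ * u))) * Lc * n)
          + (C₁ * u) * (2 * (A * cΔ * u) + 2 * (A * cΔ * u) * Lc * n))
      ≤ (2 * Tb * C₁ * cΔ + TΔ * C₁ ^ 2) * u ^ 2 * (((n : ℝ) + 1) * (4 * A + 4 * A ^ 2 + 4 * A * Lc + 8 * A ^ 2 * Lc)) := by
  have hL : (0 : ℝ) ≤ (Lc : ℝ) := Nat.cast_nonneg _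
  have hn : (0 : ℝ) ≤ n := Nat.cast_nonneg _
  have hA : 0 ≤ (2 * Tb * C₁ * cΔ + TΔ * C₁ ^ 2) * u ^ 2 := by positivity
  -- exact expansion: every bracket is the SAME polynomial `R(n) = 32Lc + 256Lc² + (32Lc² + 512Lc³)·n`
  have e : Tb * ((C₁ * u) * (2 * (A * cΔ * u) + 2 * (A * cΔ * u) * Lc * n)
          + (4 * ((A * cΔ * u) * (A * C₁ * u)) + 2 * (4 * ((A * cΔ * u) * (A * C₁ * u))) * Lc * n)
          + (cΔ * u) * (2 * (A * C₁ * u) + 2 * (A * C₁ * u) * Lc * n))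
      + TΔ * ((C₁ * u) * (2 * (A * C₁ * u) + 2 * (A * C₁ * u) * Lc * n)
          + (4 * ((A * C₁ * u) * (A * C₁ * u)) + 2 * (4 * ((A * C₁ * u) * (A * C₁ * u))) * Lc * n)
          + (C₁ * u) * (2 * (A * C₁ * u) + 2 * (A * C₁ * u) * Lc * n))
      + Tb * ((cΔ * u) * (2 * (A * C₁ * u) + 2 * (A * C₁ * u) * Lc * n)
          + (4 * ((A * C₁ * u) * (A * cΔ * u)) + 2 * (4 * ((A * C₁ * u) * (A * cΔ * u))) * Lc * n)
          + (C₁ * u) * (2 * (A * cΔ * u) + 2 * (A * cΔ * u) * Lc * n))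
      = ((2 * Tb * C₁ * cΔ + TΔ * C₁ ^ 2) * u ^ 2) * (4 * A + 4 * A ^ 2 + (4 * A * Lc + 8 * A ^ 2 * Lc) * n) := by ring
  rw [e]
  refine mul_le_mul_of_nonneg_left ?_ hA
  have h1 : 0 ≤ 4 * A + 4 * A ^ 2 := by positivity
  have h2 : 0 ≤ 4 * A * Lc + 8 * A ^ 2 * Lc := by positivity
  nlinarith [mul_nonneg h1 hn, mul_nonneg h2 hn]


/-- [folklore] **THE ARITHMETIC OF THE PAIR COUNT** (pure real algebra; `d = 3` exponents): if the fm pair and the mf pair of cells are bounded by (B)'s shapes with the letters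
`K_B = C₁·u₀`, `α_g = 8·Lc·C₁·u₀`, `K_Δ = c_Δ·u₀`, `α_Δ = 8·Lc·c_Δ·u₀`, tents `T_b·q₇`, `T_Δ·q₇` (`u₀ = (Lc^{5(n+1)})⁻¹`, `q₇ = ((Lc^n)^7)⁻¹`) and envelopes centred at `z` resp. `x`, then
the weighted difference is below `|cVH|·C_pair·((n+1)·(Lc⁻¹)^{n+1})·e^{−(κ∕96)(|x−u′|₁+|z−u′|₁)}` — §1, (C2)'s re-centring, leaf-02's `units_le`. -/
theorem weighted_comb_pair_le_of_cells {Lc : ℕ} [NeZero Lc] {cE cVH C₁ cΔ Tb TΔ κ FM MF A : ℝ} {n : ℕ} (hcE : |cE| ≤ (Lc : ℝ) ^ 4)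
    (hC₁ : 0 ≤ C₁) (hcΔ : 0 ≤ cΔ) (hTb : 0 ≤ Tb) (hTΔ : 0 ≤ TΔ) (hA : 0 ≤ A) (hκ : 0 < κ) {Φ Cn : ℝ} (hΦ : 0 ≤ Φ) (hCn : 0 ≤ Cn) (x z u' : Site (3 + 1))
    (hfm : |FM| ≤ Φ *
          ((((3 : ℝ) + 1) * (Real.exp (2 * ((3 : ℝ) + 1) * κ) ^ 2 *
              Cn))
            * ((Tb * ((((Lc : ℝ) ^ n) ^ (2 * 3 + 1))⁻¹)) * ((C₁ * ((Lc : ℝ) ^ (5 * (n + 1)))⁻¹) * (2 * (A * cΔ * ((Lc : ℝ) ^ (5 * (n + 1)))⁻¹) + 2 * (A * cΔ * ((Lc : ℝ) ^ (5 * (n + 1)))⁻¹) * Lc * n)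
                  + (4 * ((A * cΔ * ((Lc : ℝ) ^ (5 * (n + 1)))⁻¹) * (A * C₁ * ((Lc : ℝ) ^ (5 * (n + 1)))⁻¹))
                    + 2 * (4 * ((A * cΔ * ((Lc : ℝ) ^ (5 * (n + 1)))⁻¹) * (A * C₁ * ((Lc : ℝ) ^ (5 * (n + 1)))⁻¹))) * Lc * n)
                  + (cΔ * ((Lc : ℝ) ^ (5 * (n + 1)))⁻¹) * (2 * (A * C₁ * ((Lc : ℝ) ^ (5 * (n + 1)))⁻¹) + 2 * (A * C₁ * ((Lc : ℝ) ^ (5 * (n + 1)))⁻¹) * Lc * n))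
              + (TΔ * ((((Lc : ℝ) ^ n) ^ (2 * 3 + 1))⁻¹)) * ((C₁ * ((Lc : ℝ) ^ (5 * (n + 1)))⁻¹) * (2 * (A * C₁ * ((Lc : ℝ) ^ (5 * (n + 1)))⁻¹) + 2 * (A * C₁ * ((Lc : ℝ) ^ (5 * (n + 1)))⁻¹) * Lc * n)
                  + (4 * ((A * C₁ * ((Lc : ℝ) ^ (5 * (n + 1)))⁻¹) * (A * C₁ * ((Lc : ℝ) ^ (5 * (n + 1)))⁻¹))
                    + 2 * (4 * ((A * C₁ * ((Lc : ℝ) ^ (5 * (n + 1)))⁻¹) * (A * C₁ * ((Lc : ℝ) ^ (5 * (n + 1)))⁻¹))) * Lc * n)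
                  + (C₁ * ((Lc : ℝ) ^ (5 * (n + 1)))⁻¹) * (2 * (A * C₁ * ((Lc : ℝ) ^ (5 * (n + 1)))⁻¹) + 2 * (A * C₁ * ((Lc : ℝ) ^ (5 * (n + 1)))⁻¹) * Lc * n))
              + (Tb * ((((Lc : ℝ) ^ n) ^ (2 * 3 + 1))⁻¹)) * ((cΔ * ((Lc : ℝ) ^ (5 * (n + 1)))⁻¹) * (2 * (A * C₁ * ((Lc : ℝ) ^ (5 * (n + 1)))⁻¹) + 2 * (A * C₁ * ((Lc : ℝ) ^ (5 * (n + 1)))⁻¹) * Lc * n)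
                  + (4 * ((A * C₁ * ((Lc : ℝ) ^ (5 * (n + 1)))⁻¹) * (A * cΔ * ((Lc : ℝ) ^ (5 * (n + 1)))⁻¹))
                    + 2 * (4 * ((A * C₁ * ((Lc : ℝ) ^ (5 * (n + 1)))⁻¹) * (A * cΔ * ((Lc : ℝ) ^ (5 * (n + 1)))⁻¹))) * Lc * n)
                  + (C₁ * ((Lc : ℝ) ^ (5 * (n + 1)))⁻¹) * (2 * (A * cΔ * ((Lc : ℝ) ^ (5 * (n + 1)))⁻¹) + 2 * (A * cΔ * ((Lc : ℝ) ^ (5 * (n + 1)))⁻¹) * Lc * n)))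
            * ((((Lc ^ n : ℕ) : ℝ)) ^ (3 + 1) * Zl (3 + 1) (κ / (4 * ((3 : ℝ) + 1))))
            * Real.exp (-(κ / 12) * (supNorm (x - z) + supNorm (u' - z)))))
    (hmf : |MF| ≤ Φ *
          ((((3 : ℝ) + 1) * (Real.exp (2 * ((3 : ℝ) + 1) * κ) ^ 2 *
              Cn))
            * ((TΔ * ((((Lc : ℝ) ^ n) ^ (2 * 3 + 1))⁻¹)) * ((C₁ * ((Lc : ℝ) ^ (5 * (n + 1)))⁻¹) * (2 * (A * C₁ * ((Lc : ℝ) ^ (5 * (n + 1)))⁻¹) + 2 * (A * C₁ * ((Lc : ℝ) ^ (5 * (n + 1)))⁻¹) * Lc * n)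
                  + (4 * ((A * C₁ * ((Lc : ℝ) ^ (5 * (n + 1)))⁻¹) * (A * C₁ * ((Lc : ℝ) ^ (5 * (n + 1)))⁻¹))
                    + 2 * (4 * ((A * C₁ * ((Lc : ℝ) ^ (5 * (n + 1)))⁻¹) * (A * C₁ * ((Lc : ℝ) ^ (5 * (n + 1)))⁻¹))) * Lc * n)
                  + (C₁ * ((Lc : ℝ) ^ (5 * (n + 1)))⁻¹) * (2 * (A * C₁ * ((Lc : ℝ) ^ (5 * (n + 1)))⁻¹) + 2 * (A * C₁ * ((Lc : ℝ) ^ (5 * (n + 1)))⁻¹) * Lc * n))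
              + (Tb * ((((Lc : ℝ) ^ n) ^ (2 * 3 + 1))⁻¹)) * ((C₁ * ((Lc : ℝ) ^ (5 * (n + 1)))⁻¹) * (2 * (A * cΔ * ((Lc : ℝ) ^ (5 * (n + 1)))⁻¹) + 2 * (A * cΔ * ((Lc : ℝ) ^ (5 * (n + 1)))⁻¹) * Lc * n)
                  + (4 * ((A * cΔ * ((Lc : ℝ) ^ (5 * (n + 1)))⁻¹) * (A * C₁ * ((Lc : ℝ) ^ (5 * (n + 1)))⁻¹))
                    + 2 * (4 * ((A * cΔ * ((Lc : ℝ) ^ (5 * (n + 1)))⁻¹) * (A * C₁ * ((Lc : ℝ) ^ (5 * (n + 1)))⁻¹))) * Lc * n)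
                  + (cΔ * ((Lc : ℝ) ^ (5 * (n + 1)))⁻¹) * (2 * (A * C₁ * ((Lc : ℝ) ^ (5 * (n + 1)))⁻¹) + 2 * (A * C₁ * ((Lc : ℝ) ^ (5 * (n + 1)))⁻¹) * Lc * n))
              + (Tb * ((((Lc : ℝ) ^ n) ^ (2 * 3 + 1))⁻¹)) * ((cΔ * ((Lc : ℝ) ^ (5 * (n + 1)))⁻¹) * (2 * (A * C₁ * ((Lc : ℝ) ^ (5 * (n + 1)))⁻¹) + 2 * (A * C₁ * ((Lc : ℝ) ^ (5 * (n + 1)))⁻¹) * Lc * n)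
                  + (4 * ((A * C₁ * ((Lc : ℝ) ^ (5 * (n + 1)))⁻¹) * (A * cΔ * ((Lc : ℝ) ^ (5 * (n + 1)))⁻¹))
                    + 2 * (4 * ((A * C₁ * ((Lc : ℝ) ^ (5 * (n + 1)))⁻¹) * (A * cΔ * ((Lc : ℝ) ^ (5 * (n + 1)))⁻¹))) * Lc * n)
                  + (C₁ * ((Lc : ℝ) ^ (5 * (n + 1)))⁻¹) * (2 * (A * cΔ * ((Lc : ℝ) ^ (5 * (n + 1)))⁻¹) + 2 * (A * cΔ * ((Lc : ℝ) ^ (5 * (n + 1)))⁻¹) * Lc * n)))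
            * ((((Lc ^ n : ℕ) : ℝ)) ^ (3 + 1) * Zl (3 + 1) (κ / (4 * ((3 : ℝ) + 1))))
            * Real.exp (-(κ / 12) * (supNorm (z - x) + supNorm (u' - x))))) :
    |cE * (Lc : ℝ) ^ (2 * (3 + 1))| ^ (n + 1) * |cVH| * |MF - FM|
      ≤ |cVH| * (2 * ((Lc : ℝ) ^ 3 * (Φ * (((3 : ℝ) + 1) * (Real.exp (2 * ((3 : ℝ) + 1) * κ) ^ 2 *
              Cn))
            * ((2 * Tb * C₁ * cΔ + TΔ * C₁ ^ 2) * (4 * A + 4 * A ^ 2 + 4 * A * Lc + 8 * A ^ 2 * Lc))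
            * Zl (3 + 1) (κ / (4 * ((3 : ℝ) + 1))))))
          * ((((n : ℝ) + 1)) * ((Lc : ℝ)⁻¹) ^ (n + 1))
          * Real.exp (-(κ / 12 / 2 / ((3 : ℝ) + 1)) * (l1 (x - u') + l1 (z - u'))) := by
  have hL : (0 : ℝ) < (Lc : ℝ) := Nat.cast_pos.2 (Nat.pos_of_ne_zero (NeZero.ne Lc))
  have hZ : 0 ≤ Zl (3 + 1) (κ / (4 * ((3 : ℝ) + 1))) := Zl_nonneg (by positivity)
  -- |mf − fm| ≤ |mf| + |fm|
  refine (mul_le_mul_of_nonneg_left ((abs_sub _ _).trans (add_le_add hmf hfm)) (by positivity)).trans ?_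
  clear hmf hfm
  -- name the atoms
  set u₀ : ℝ := ((Lc : ℝ) ^ (5 * (n + 1)))⁻¹ with hu₀
  set q7 : ℝ := (((Lc : ℝ) ^ n) ^ (2 * 3 + 1))⁻¹ with hq7
  set K : ℝ := ((3 : ℝ) + 1) * (Real.exp (2 * ((3 : ℝ) + 1) * κ) ^ 2 *
    Cn) with hKdef
  set Y4 : ℝ := (((Lc ^ n : ℕ) : ℝ)) ^ (3 + 1) with hY4
  set ZZ : ℝ := Zl (3 + 1) (κ / (4 * ((3 : ℝ) + 1))) with hZZ
  set L3 : ℝ := (4 * A + 4 * A ^ 2 + 4 * A * Lc + 8 * A ^ 2 * Lc) with hL3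
  set EXP : ℝ := Real.exp (-(κ / 12 / 2 / ((3 : ℝ) + 1)) * (l1 (x - u') + l1 (z - u'))) with hEXP
  set W : ℝ := |cE * (Lc : ℝ) ^ (2 * (3 + 1))| ^ (n + 1) with hW
  have hu₀0 : 0 ≤ u₀ := by positivity
  have hq70 : 0 ≤ q7 := by positivity
  have hK0 : 0 ≤ K := by positivity
  have hY40 : 0 ≤ Y4 := by positivity
  have hL30 : 0 ≤ L3 := by positivity
  have hEXP0 : 0 ≤ EXP := (Real.exp_pos _).le
  have hW0 : 0 ≤ W := by positivity
  -- the polynomials against §1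
  have hP := polyPairA_le (Lc := Lc) (u := u₀) (mul_nonneg hTb hq70) (mul_nonneg hTΔ hq70) hC₁ hcΔ hA n
  have hPP : (2 * (Tb * q7) * C₁ * cΔ + (TΔ * q7) * C₁ ^ 2) * u₀ ^ 2 * (((n : ℝ) + 1) * L3)
      = (q7 * u₀ ^ 2) * ((2 * Tb * C₁ * cΔ + TΔ * C₁ ^ 2) * (((n : ℝ) + 1) * L3)) := by ring
  have hPfm : (Tb * q7) * ((C₁ * u₀) * (2 * (A * cΔ * u₀) + 2 * (A * cΔ * u₀) * Lc * n)
          + (4 * ((A * cΔ * u₀) * (A * C₁ * u₀)) + 2 * (4 * ((A * cΔ * u₀) * (A * C₁ * u₀))) * Lc * n)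
          + (cΔ * u₀) * (2 * (A * C₁ * u₀) + 2 * (A * C₁ * u₀) * Lc * n))
      + (TΔ * q7) * ((C₁ * u₀) * (2 * (A * C₁ * u₀) + 2 * (A * C₁ * u₀) * Lc * n)
          + (4 * ((A * C₁ * u₀) * (A * C₁ * u₀)) + 2 * (4 * ((A * C₁ * u₀) * (A * C₁ * u₀))) * Lc * n)
          + (C₁ * u₀) * (2 * (A * C₁ * u₀) + 2 * (A * C₁ * u₀) * Lc * n))
      + (Tb * q7) * ((cΔ * u₀) * (2 * (A * C₁ * u₀) + 2 * (A * C₁ * u₀) * Lc * n)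
          + (4 * ((A * C₁ * u₀) * (A * cΔ * u₀)) + 2 * (4 * ((A * C₁ * u₀) * (A * cΔ * u₀))) * Lc * n)
          + (C₁ * u₀) * (2 * (A * cΔ * u₀) + 2 * (A * cΔ * u₀) * Lc * n))
      ≤ (q7 * u₀ ^ 2) * ((2 * Tb * C₁ * cΔ + TΔ * C₁ ^ 2) * (((n : ℝ) + 1) * L3)) := by
    rw [← hPP]; exact hP
  have hPmf : (TΔ * q7) * ((C₁ * u₀) * (2 * (A * C₁ * u₀) + 2 * (A * C₁ * u₀) * Lc * n)
          + (4 * ((A * C₁ * u₀) * (A * C₁ * u₀)) + 2 * (4 * ((A * C₁ * u₀) * (A * C₁ * u₀))) * Lc * n)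
          + (C₁ * u₀) * (2 * (A * C₁ * u₀) + 2 * (A * C₁ * u₀) * Lc * n))
      + (Tb * q7) * ((C₁ * u₀) * (2 * (A * cΔ * u₀) + 2 * (A * cΔ * u₀) * Lc * n)
          + (4 * ((A * cΔ * u₀) * (A * C₁ * u₀)) + 2 * (4 * ((A * cΔ * u₀) * (A * C₁ * u₀))) * Lc * n)
          + (cΔ * u₀) * (2 * (A * C₁ * u₀) + 2 * (A * C₁ * u₀) * Lc * n))
      + (Tb * q7) * ((cΔ * u₀) * (2 * (A * C₁ * u₀) + 2 * (A * C₁ * u₀) * Lc * n)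
          + (4 * ((A * C₁ * u₀) * (A * cΔ * u₀)) + 2 * (4 * ((A * C₁ * u₀) * (A * cΔ * u₀))) * Lc * n)
          + (C₁ * u₀) * (2 * (A * cΔ * u₀) + 2 * (A * cΔ * u₀) * Lc * n))
      ≤ (q7 * u₀ ^ 2) * ((2 * Tb * C₁ * cΔ + TΔ * C₁ ^ 2) * (((n : ℝ) + 1) * L3)) := by
    refine le_trans (le_of_eq ?_) hPfm
    abel
  -- the envelopes re-centred at `u′` in `ℓ¹` currency
  have hEXz : Real.exp (-(κ / 12) * (supNorm (x - z) + supNorm (u' - z))) ≤ EXP :=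
    (exp_recenter_right_le (c := κ / 12) (by positivity) x z u').trans
      (exp_supNorm_add_le_exp_l1 (d := 3) (c := κ / 12 / 2) (by positivity) (x - u') (z - u'))
  have hEXx : Real.exp (-(κ / 12) * (supNorm (z - x) + supNorm (u' - x))) ≤ EXP :=
    (exp_recenter_left_le (c := κ / 12) (by positivity) x z u').trans
      (exp_supNorm_add_le_exp_l1 (d := 3) (c := κ / 12 / 2) (by positivity) (x - u') (z - u'))
  -- each pair bound ≤ the same bound with §1's polynomial and the re-centred envelope
  have hPP0 : 0 ≤ (q7 * u₀ ^ 2) * ((2 * Tb * C₁ * cΔ + TΔ * C₁ ^ 2) * (((n : ℝ) + 1) * L3)) := by positivity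
  have key : ∀ {EX POLY : ℝ}, 0 ≤ EX → EX ≤ EXP → POLY ≤ (q7 * u₀ ^ 2) * ((2 * Tb * C₁ * cΔ + TΔ * C₁ ^ 2) * (((n : ℝ) + 1) * L3)) →
      Φ * (K * POLY * (Y4 * ZZ) * EX)
        ≤ Φ * (K * ((q7 * u₀ ^ 2) * ((2 * Tb * C₁ * cΔ + TΔ * C₁ ^ 2) * (((n : ℝ) + 1) * L3))) * (Y4 * ZZ) * EXP) := by
    intro EX POLY hEX0 hEX hPOLY
    refine mul_le_mul_of_nonneg_left ?_ (by positivity)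
    calc K * POLY * (Y4 * ZZ) * EX ≤ K * ((q7 * u₀ ^ 2) * ((2 * Tb * C₁ * cΔ + TΔ * C₁ ^ 2) * (((n : ℝ) + 1) * L3))) * (Y4 * ZZ) * EX :=
          mul_le_mul_of_nonneg_right (mul_le_mul_of_nonneg_right (mul_le_mul_of_nonneg_left hPOLY hK0) (mul_nonneg hY40 hZ)) hEX0
      _ ≤ K * ((q7 * u₀ ^ 2) * ((2 * Tb * C₁ * cΔ + TΔ * C₁ ^ 2) * (((n : ℝ) + 1) * L3))) * (Y4 * ZZ) * EXP :=
          mul_le_mul_of_nonneg_left hEX (mul_nonneg (mul_nonneg hK0 hPP0) (mul_nonneg hY40 hZ))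
  refine (mul_le_mul_of_nonneg_left (add_le_add (key (Real.exp_pos _).le hEXx hPmf) (key (Real.exp_pos _).le hEXz hPfm))
    (by positivity)).trans ?_
  -- the powers: `units_le`
  have hU : W * (q7 * (u₀ ^ 2 * Y4)) ≤ (Lc : ℝ) ^ 3 * ((Lc : ℝ)⁻¹) ^ (n + 1) := by
    have h := units_le (Lc := Lc) hcE n
    rw [hW, hq7, hu₀, hY4]
    exact h
  have hR0 : 0 ≤ |cVH| * (2 * (Φ * K * ((2 * Tb * C₁ * cΔ + TΔ * C₁ ^ 2) * L3) * ZZ)) * (((n : ℝ) + 1)) * EXP := by positivity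
  calc W * |cVH| *
        (Φ * (K * ((q7 * u₀ ^ 2) * ((2 * Tb * C₁ * cΔ + TΔ * C₁ ^ 2) * (((n : ℝ) + 1) * L3))) * (Y4 * ZZ) * EXP)
          + Φ * (K * ((q7 * u₀ ^ 2) * ((2 * Tb * C₁ * cΔ + TΔ * C₁ ^ 2) * (((n : ℝ) + 1) * L3))) * (Y4 * ZZ) * EXP))
      = (W * (q7 * (u₀ ^ 2 * Y4)))
        * (|cVH| * (2 * (Φ * K * ((2 * Tb * C₁ * cΔ + TΔ * C₁ ^ 2) * L3) * ZZ)) * (((n : ℝ) + 1)) * EXP) := by ring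
    _ ≤ ((Lc : ℝ) ^ 3 * ((Lc : ℝ)⁻¹) ^ (n + 1))
        * (|cVH| * (2 * (Φ * K * ((2 * Tb * C₁ * cΔ + TΔ * C₁ ^ 2) * L3) * ZZ)) * (((n : ℝ) + 1)) * EXP) :=
      mul_le_mul_of_nonneg_right hU hR0
    _ = _ := by ring

end Summit.QuantumFields.BalabanUV.Beta.GAN24.CombBornBorderContactPairCount
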